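import Mathlib.NumberTheory.Padics.PadicVal.Basic
import Mathlib.Data.ZMod.Basic
import Mathlib.Tactic
import HarnessLib

/-!
# Weil-type family coverage — THEOREM S3 (block defect) for Schur-index-one pieces: the arithmetic skeleton

research route conditional on HC_CM; not a corollary; Q11.4-sentence-2 already refuted in dim ≥ 3.

Ring 2, WEIL-TYPE FAMILY-COVERAGE CENSUS (`HOME/WEIL-FAMILY-COVERAGE.md` `## b04`, block b04.12, owner ring2-b04, gen 48).
Setting of the census's Schur-index-one window (b04.11 P.S. (G)): `G` a finite group acting on a curve `C̃`, `χ` an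
irreducible character whose field of values `ℚ(χ) = K = ℚ(√-q)` is imaginary quadratic, `P_χ ⊂ J(C̃)` the
`(χ ⊕ χ̄)`-isotypic abelian subvariety with its induced polarisation `E` and `K` acting through the CENTRE of `ℚ[G]`,
`H` the `K`-hermitian form of `E`, `a = (−1)ⁿ det H > 0` when the `K`-signature is `(n, n)` (Weil type); the census row
of `P_χ` is decided by the class of `a` in `ℚˣ/Nm(Kˣ)`, i.e. by the finite set `T(a)` of primes at which `a` is not a
local norm.

**THEOREM S3 (census b04.12 (A), seat-derived; proof in the census, inputs: `ℤ_p[G]` is a maximal order for `p ∤ |G|`;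
a `p`-block of DEFECT ZERO (`|G|_p ∣ χ(1)`) has a `p`-integral central idempotent and block algebra `M_d(𝒪)`, a maximal
order; an orthogonal direct summand of the unimodular lattice `H¹(C̃, ℤ_p)` is unimodular; a unimodular hermitian lattice
over the unramified `𝒪_{K,p}` has unit determinant; units are norms from unramified extensions; Hilbert reciprocity).**
`T(a) ⊆ S_in(G, χ) ∪ Ram(K)`, where `S_in(G, χ) = {p ∣ |G| : p inert in K and χ NOT of p-defect zero}`, and the number of
places in `S_in ∪ Ram(K)` at which `a` fails to be a local norm is EVEN.  COROLLARY: `|S_in ∪ Ram(K)| ≤ 1 ⟹ P_χ` lies on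
the SPLIT row, for EVERY `G`-curve, every base genus, every branch datum.

This file certifies the finite-group ARITHMETIC that turns S3 into the census's COROLLARY P for `G = PSL₂(𝔽_q)`,
`q ≡ 3 (mod 4)` prime, `χ = η₁, η₂` cuspidal of degree `(q−1)/2`, `K = ℚ(√-q)` (`Ram(K) = {q}`), `|G| = q·((q−1)/2)·(q+1)`:

* §1 `isSquare_neg_natCast_of_dvd_add_one`: `p ∣ q + 1 ⟹ −q ≡ 1` is a square mod `p` (odd primes dividing `q + 1`
  are SPLIT in `K`);
* §2 `padicValNat_psl2Order_eq_of_not_isSquare`: if `−q` is a NON-square mod a prime `p ∤ q` then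
  `v_p(q·((q−1)/2)·(q+1)) = v_p((q−1)/2)` — every non-split prime `p ≠ q` is of DEFECT ZERO for `η`;
* §3 `psl2_odd_prime_split_or_defectZero`: the dichotomy for odd `p ≠ q`; and §4 the prime `2`:
  `exists_sq_eq_neg_iff_mod_eight` — for odd `q`, `x² ≡ −q (mod 8)` is solvable iff `q ≡ 7 (mod 8)` (2 split), so
  `S_in(PSL₂(𝔽_q), η) = ∅` for `q ≡ 7 (mod 8)` (ALWAYS SPLIT: `q = 7, 23, 31, 47, 71, …`) and `= {2}` for `q ≡ 3 (mod 8)`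
  (ONE free bit, `T(a) ∈ {∅, {2, q}}`: `q = 3, 11, 19, 43, 67, 163` among the census fields) — §5 records the literal
  residue / valuation facts for `q = 7, 11, 19, 23, 43, 67, 163` and for the Frobenius groups `F_{q(q−1)/2}` (all
  `p ≠ q` of defect zero: ALWAYS SPLIT) and `GL₂(𝔽₃)` over `ℚ(√-2)` (`3` split, `Ram = {2}`: ALWAYS SPLIT).

This closes the question left OPEN in b04.11 P.S. (G2′) («whether `(3, ℚ(√-7), 3)` is ever met by `PSL₂(𝔽₇)` / `F₂₁`
pieces»): NO — `3` is inert of defect zero, `2` is split, `Ram = {7}`.  Nothing in this file is a statement about Hodge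
classes; no `def`, no named fact, no `sorry`; `HC_CM` is used nowhere.

References: [cite: vanGeemen1994HodgeAV, 5.4 and (5.4.1)] (the invariant `det H`); [cite: NavarroTiep2021, Thm. A1–A2]
(odd-degree characters with quadratic fields `ℚ(√d)` need `d ≡ 1 (mod 4)`); Serre, *Linear representations of finite
groups*, §15.5–§16.4 (blocks of defect zero / projective lattices); Reiner, *Maximal orders*, (21.6), (41.1).
-/

set_option linter.dupNamespace false

namespace Summit.HodgeConjecture.HodgeConjecture.Ring2.WeilCoverage

/-! ### §1 Odd primes dividing `q + 1` are split in `ℚ(√-q)` -/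

/-- If `p ∣ q + 1` then `−q ≡ 1 (mod p)` is a square: the odd primes dividing `q + 1` (the non-split torus order of
`PSL₂(𝔽_q)`, up to `2`) are SPLIT in `ℚ(√-q)`.
research route conditional on HC_CM; not a corollary; Q11.4-sentence-2 already refuted in dim ≥ 3. [folklore] -/
theorem isSquare_neg_natCast_of_dvd_add_one {p q : ℕ} (h : p ∣ q + 1) : IsSquare (-(q : ZMod p)) := by
  refine ⟨1, ?_⟩
  have h0 : ((q + 1 : ℕ) : ZMod p) = 0 := (ZMod.natCast_eq_zero_iff (q + 1) p).2 h
  push_cast at h0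
  linear_combination -h0

/-- Contrapositive of §1: a prime at which `−q` is a non-residue does not divide `q + 1`.
research route conditional on HC_CM; not a corollary; Q11.4-sentence-2 already refuted in dim ≥ 3. [folklore] -/
theorem not_dvd_add_one_of_not_isSquare {p q : ℕ} (h : ¬ IsSquare (-(q : ZMod p))) : ¬ p ∣ q + 1 :=
  fun hd => h (isSquare_neg_natCast_of_dvd_add_one hd)

/-! ### §2 Defect zero of the cuspidal characters at every non-split prime `p ≠ q` -/

/-- **Defect zero (THEOREM S3's input for `PSL₂(𝔽_q)`).** Let `p` be a prime with `p ∤ q` and `−q` a NON-square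
mod `p` (for odd `p`: `p` inert in `ℚ(√-q)`).  Then `v_p(q · ((q−1)/2) · (q+1)) = v_p((q−1)/2)`: the `p`-part of
`|PSL₂(𝔽_q)| = q(q²−1)/2` divides the degree `(q−1)/2` of the cuspidal characters `η₁, η₂` — they are of
`p`-DEFECT ZERO, so their block idempotent is `p`-integral and the `η`-lattice of any `G`-curve is a unimodular
`𝒪_{K,p}`-hermitian direct summand (census b04.12 (A)).
research route conditional on HC_CM; not a corollary; Q11.4-sentence-2 already refuted in dim ≥ 3. [folklore] -/
theorem padicValNat_psl2Order_eq_of_not_isSquare {p q : ℕ} (hp : p.Prime) (hpq : ¬ p ∣ q)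
    (hns : ¬ IsSquare (-(q : ZMod p))) :
    padicValNat p (q * ((q - 1) / 2) * (q + 1)) = padicValNat p ((q - 1) / 2) := by
  haveI := Fact.mk hp
  have h1 : ¬ p ∣ q + 1 := not_dvd_add_one_of_not_isSquare hns
  have hq0 : q ≠ 0 := by rintro rfl; exact hpq (dvd_zero p)
  by_cases hm : (q - 1) / 2 = 0
  · simp [hm]
  rw [padicValNat.mul (mul_ne_zero hq0 hm) (Nat.succ_ne_zero q), padicValNat.mul hq0 hm,
    padicValNat.eq_zero_of_not_dvd hpq, padicValNat.eq_zero_of_not_dvd h1]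
  simp

/-- The order bookkeeping: for odd `q`, `q · ((q−1)/2) · (q+1)` is `|PSL₂(𝔽_q)| = q(q−1)(q+1)/2`.
research route conditional on HC_CM; not a corollary; Q11.4-sentence-2 already refuted in dim ≥ 3. [folklore] -/
theorem psl2Order_two_mul (q : ℕ) (hq : q % 2 = 1) :
    2 * (q * ((q - 1) / 2) * (q + 1)) = q * (q - 1) * (q + 1) := by
  have h : (q - 1) / 2 * 2 = q - 1 := Nat.div_mul_cancel (by omega)
  calc 2 * (q * ((q - 1) / 2) * (q + 1)) = q * ((q - 1) / 2 * 2) * (q + 1) := by ring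
    _ = q * (q - 1) * (q + 1) := by rw [h]

/-! ### §3 The dichotomy for odd primes and the corollary shape -/

/-- **COROLLARY P, odd primes.** For every prime `p` with `p ∤ q`: either `−q` is a square mod `p` (for odd `p`:
`p` SPLIT in `ℚ(√-q)` — every local unit and `p` itself are norms), or `p` is of defect zero for the cuspidal
characters.  Hence no odd prime `p ≠ q` ever carries an obstruction to `a ∈ Nm(ℚ(√-q)ˣ)` for an `η`-piece of a
`PSL₂(𝔽_q)`-curve (THEOREM S3).
research route conditional on HC_CM; not a corollary; Q11.4-sentence-2 already refuted in dim ≥ 3. [folklore] -/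
theorem psl2_prime_split_or_defectZero {p q : ℕ} (hp : p.Prime) (hpq : ¬ p ∣ q) :
    IsSquare (-(q : ZMod p)) ∨
      padicValNat p (q * ((q - 1) / 2) * (q + 1)) = padicValNat p ((q - 1) / 2) := by
  by_cases hs : IsSquare (-(q : ZMod p))
  · exact Or.inl hs
  · exact Or.inr (padicValNat_psl2Order_eq_of_not_isSquare hp hpq hs)

/-- The Frobenius groups `F = C_q ⋊ C_{(q−1)/2}` (`q ≡ 3 (mod 4)`; `F₂₁` for `q = 7`), whose two characters of degree
`(q−1)/2` induced from `C_q` have `ℚ(χ) = ℚ(√-q)`: EVERY prime `p ∤ q` is of defect zero (`|F| = q · (q−1)/2`), so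
`S_in(F, χ) = ∅`, `Ram = {q}` and every such Weil piece of every `F`-curve is SPLIT (THEOREM S3) — the census's
`F₂₁` rows `W6.7.1`, `W12.7.1`, `W18.7.1` (b04.11 P.S., 14 data) are the case `q = 7`.
research route conditional on HC_CM; not a corollary; Q11.4-sentence-2 already refuted in dim ≥ 3. [folklore] -/
theorem padicValNat_frobeniusOrder_eq {p q m : ℕ} (hp : p.Prime) (hpq : ¬ p ∣ q) :
    padicValNat p (q * m) = padicValNat p m := by
  haveI := Fact.mk hp
  have hq0 : q ≠ 0 := by rintro rfl; exact hpq (dvd_zero p)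
  by_cases hm : m = 0
  · simp [hm]
  rw [padicValNat.mul hq0 hm, padicValNat.eq_zero_of_not_dvd hpq, zero_add]

/-! ### §4 The prime `2`: split iff `q ≡ 7 (mod 8)` -/

/-- For odd `q`: `x² ≡ −q (mod 8)` is solvable iff `q ≡ 7 (mod 8)`; i.e. (`q ≡ 3 (mod 4)`, `𝒪_K = ℤ[(1+√-q)/2]`)
the prime `2` SPLITS in `ℚ(√-q)` iff `q ≡ 7 (mod 8)` and is INERT iff `q ≡ 3 (mod 8)`.  With §3: `S_in(PSL₂(𝔽_q), η)`
is EMPTY for `q ≡ 7 (mod 8)` — every `η`-piece of every `PSL₂(𝔽_q)`-curve is SPLIT — and equals `{2}` for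
`q ≡ 3 (mod 8)` (`|G|₂ = 4 ∤ (q−1)/2` odd): ONE free bit, `T(a) ∈ {∅, {2, q}}` (COROLLARY P of census b04.12).
research route conditional on HC_CM; not a corollary; Q11.4-sentence-2 already refuted in dim ≥ 3. [folklore] -/
theorem exists_sq_eq_neg_iff_mod_eight (q : ℕ) (hq : q % 2 = 1) :
    (∃ x : ZMod 8, x ^ 2 = -(q : ZMod 8)) ↔ q % 8 = 7 := by
  have hcast : (q : ZMod 8) = ((q % 8 : ℕ) : ZMod 8) := by rw [ZMod.natCast_mod]
  rw [hcast]
  have hr : q % 8 = 1 ∨ q % 8 = 3 ∨ q % 8 = 5 ∨ q % 8 = 7 := by omega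
  rcases hr with h | h | h | h <;> rw [h] <;> decide

/-- For `q ≡ 3 (mod 8)` the `2`-part of `|PSL₂(𝔽_q)|` is `4` while `(q−1)/2` is odd: the cuspidal characters are NOT
of `2`-defect zero (the one prime THEOREM S3 leaves open, together with `q`, for `q = 3, 11, 19, 43, 67, 163, …`).
research route conditional on HC_CM; not a corollary; Q11.4-sentence-2 already refuted in dim ≥ 3. [folklore] -/
theorem psl2_half_pred_odd_of_mod_eight_three (q : ℕ) (hq : q % 8 = 3) :
    ((q - 1) / 2) % 2 = 1 ∧ 4 ∣ q + 1 ∧ ¬ 2 ∣ (q - 1) / 2 := by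
  omega

/-! ### §5 Literal instances: the census primes -/

/-- `q = 7` (`|PSL₂(𝔽₇)| = 168 = 2³·3·7`, `K = ℚ(√-7)`): `3` is INERT (`−7 ≡ 2` a non-square mod `3`) and of defect
zero (`v₃(168) = 1 = v₃(3)`); `2` is SPLIT (`1² ≡ −7 (mod 8)`).  So `S_in = ∅`, `Ram = {7}`: EVERY `η`-piece of every
`PSL₂(𝔽₇)`-curve is split — the eleven `PSL₂(𝔽₇)` Weil data of b04.11 P.S. on `W6.7.1`, and the row
`(3, ℚ(√-7), [3])` is NEVER met this way (b04.11 P.S. (G2′) OPEN question, closed).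
research route conditional on HC_CM; not a corollary; Q11.4-sentence-2 already refuted in dim ≥ 3. [folklore] -/
theorem psl2_7_primes :
    ¬ IsSquare (-(7 : ZMod 3)) ∧ padicValNat 3 (7 * ((7 - 1) / 2) * (7 + 1)) = padicValNat 3 ((7 - 1) / 2) ∧
      (∃ x : ZMod 8, x ^ 2 = -(7 : ZMod 8)) ∧ 7 * ((7 - 1) / 2) * (7 + 1) = 168 := by
  refine ⟨by decide, ?_, ⟨1, by decide⟩, by norm_num⟩
  exact padicValNat_psl2Order_eq_of_not_isSquare (q := 7) Nat.prime_three (by norm_num) (by decide)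

/-- `q = 11` (`|PSL₂(𝔽₁₁)| = 660 = 2²·3·5·11`, `K = ℚ(√-11)`): `3` and `5` are SPLIT (`−11 ≡ 1 (mod 3)`,
`−11 ≡ 2² (mod 5)`), `2` is INERT (`x² ≡ −11 (mod 8)` insoluble) and NOT of defect zero (`v₂(660) = 2`,
`v₂(5) = 0`): `S_in = {2}`, `Ram = {11}` — exactly ONE free bit, `T(a) ∈ {∅, {2, 11}}`, rows `W(10m/…).11.1` or
`….11.2`; the rigid tenfold `(0; 3,3,5′)` of b04.11 P.S. 2 has `T(a) = ∅`.
research route conditional on HC_CM; not a corollary; Q11.4-sentence-2 already refuted in dim ≥ 3. [folklore] -/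
theorem psl2_11_primes :
    IsSquare (-(11 : ZMod 3)) ∧ IsSquare (-(11 : ZMod 5)) ∧ (¬ ∃ x : ZMod 8, x ^ 2 = -(11 : ZMod 8)) ∧
      padicValNat 2 (11 * ((11 - 1) / 2) * (11 + 1)) = 2 ∧ padicValNat 2 ((11 - 1) / 2) = 0 ∧
      11 * ((11 - 1) / 2) * (11 + 1) = 660 := by
  haveI : Fact (Nat.Prime 2) := ⟨Nat.prime_two⟩
  refine ⟨by decide, by decide, by decide, ?_, ?_, by norm_num⟩
  · rw [show 11 * ((11 - 1) / 2) * (11 + 1) = 2 ^ 2 * 165 by norm_num,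
      padicValNat.mul (by norm_num) (by norm_num), padicValNat.prime_pow,
      padicValNat.eq_zero_of_not_dvd (by norm_num)]
  · exact padicValNat.eq_zero_of_not_dvd (by norm_num)

/-- `q = 19` (`|PSL₂(𝔽₁₉)| = 3420 = 2²·3²·5·19`, `K = ℚ(√-19)`, `χ(1) = 9`): `3` INERT of defect zero
(`v₃(3420) = 2 = v₃(9)`), `5` SPLIT (`−19 ≡ 1 (mod 5)`), `2` INERT of positive defect: `S_in = {2}`, one free bit.
research route conditional on HC_CM; not a corollary; Q11.4-sentence-2 already refuted in dim ≥ 3. [folklore] -/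
theorem psl2_19_primes :
    ¬ IsSquare (-(19 : ZMod 3)) ∧ padicValNat 3 (19 * ((19 - 1) / 2) * (19 + 1)) = padicValNat 3 ((19 - 1) / 2) ∧
      IsSquare (-(19 : ZMod 5)) ∧ (¬ ∃ x : ZMod 8, x ^ 2 = -(19 : ZMod 8)) ∧
      19 * ((19 - 1) / 2) * (19 + 1) = 3420 := by
  refine ⟨by decide, ?_, by decide, by decide, by norm_num⟩
  exact padicValNat_psl2Order_eq_of_not_isSquare (q := 19) Nat.prime_three (by norm_num) (by decide)

/-- `q = 23` (`|PSL₂(𝔽₂₃)| = 6072 = 2³·3·11·23`, `K = ℚ(√-23)`, `χ(1) = 11`): `2` SPLIT (`23 ≡ 7 (mod 8)`), `3` SPLIT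
(`−23 ≡ 1 (mod 3)`), `11` INERT (`−23 ≡ 10` a non-square mod `11`) of defect zero (`v₁₁(6072) = 1 = v₁₁(11)`):
`S_in = ∅`, `Ram = {23}` — every `η`-piece of every `PSL₂(𝔽₂₃)`-curve is SPLIT.
research route conditional on HC_CM; not a corollary; Q11.4-sentence-2 already refuted in dim ≥ 3. [folklore] -/
theorem psl2_23_primes :
    (∃ x : ZMod 8, x ^ 2 = -(23 : ZMod 8)) ∧ IsSquare (-(23 : ZMod 3)) ∧ ¬ IsSquare (-(23 : ZMod 11)) ∧
      padicValNat 11 (23 * ((23 - 1) / 2) * (23 + 1)) = padicValNat 11 ((23 - 1) / 2) ∧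
      23 * ((23 - 1) / 2) * (23 + 1) = 6072 := by
  refine ⟨⟨1, by decide⟩, by decide, by decide, ?_, by norm_num⟩
  exact padicValNat_psl2Order_eq_of_not_isSquare (q := 23) (by norm_num) (by norm_num) (by decide)

/-- `q = 43` (`|PSL₂(𝔽₄₃)| = 39732 = 2²·3·7·11·43`, `K = ℚ(√-43)`, `χ(1) = 21`): `3`, `7` INERT of defect zero,
`11` SPLIT (`−43 ≡ 1 (mod 11)`), `2` INERT of positive defect: `S_in = {2}`, one free bit.
research route conditional on HC_CM; not a corollary; Q11.4-sentence-2 already refuted in dim ≥ 3. [folklore] -/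
theorem psl2_43_primes :
    ¬ IsSquare (-(43 : ZMod 3)) ∧ ¬ IsSquare (-(43 : ZMod 7)) ∧ IsSquare (-(43 : ZMod 11)) ∧
      (¬ ∃ x : ZMod 8, x ^ 2 = -(43 : ZMod 8)) ∧
      padicValNat 3 (43 * ((43 - 1) / 2) * (43 + 1)) = padicValNat 3 ((43 - 1) / 2) ∧
      padicValNat 7 (43 * ((43 - 1) / 2) * (43 + 1)) = padicValNat 7 ((43 - 1) / 2) ∧
      43 * ((43 - 1) / 2) * (43 + 1) = 39732 := by
  refine ⟨by decide, by decide, by decide, by decide, ?_, ?_, by norm_num⟩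
  · exact padicValNat_psl2Order_eq_of_not_isSquare (q := 43) Nat.prime_three (by norm_num) (by decide)
  · exact padicValNat_psl2Order_eq_of_not_isSquare (q := 43) (by norm_num) (by norm_num) (by decide)

/-- `q = 67` (`|PSL₂(𝔽₆₇)| = 150348 = 2²·3·11·17·67`, `K = ℚ(√-67)`, `χ(1) = 33`): `3`, `11` INERT of defect zero,
`17` SPLIT (`−67 ≡ 1 (mod 17)`), `2` INERT of positive defect: `S_in = {2}`, one free bit.
research route conditional on HC_CM; not a corollary; Q11.4-sentence-2 already refuted in dim ≥ 3. [folklore] -/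
theorem psl2_67_primes :
    ¬ IsSquare (-(67 : ZMod 3)) ∧ ¬ IsSquare (-(67 : ZMod 11)) ∧ IsSquare (-(67 : ZMod 17)) ∧
      (¬ ∃ x : ZMod 8, x ^ 2 = -(67 : ZMod 8)) ∧
      padicValNat 3 (67 * ((67 - 1) / 2) * (67 + 1)) = padicValNat 3 ((67 - 1) / 2) ∧
      padicValNat 11 (67 * ((67 - 1) / 2) * (67 + 1)) = padicValNat 11 ((67 - 1) / 2) ∧
      67 * ((67 - 1) / 2) * (67 + 1) = 150348 := by
  refine ⟨by decide, by decide, by decide, by decide, ?_, ?_, by norm_num⟩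
  · exact padicValNat_psl2Order_eq_of_not_isSquare (q := 67) Nat.prime_three (by norm_num) (by decide)
  · exact padicValNat_psl2Order_eq_of_not_isSquare (q := 67) (by norm_num) (by norm_num) (by decide)

/-- `q = 163` (`|PSL₂(𝔽₁₆₃)| = 2165292 = 2²·3⁴·41·163`, `K = ℚ(√-163)`, `χ(1) = 81`): `3` INERT of defect zero
(`v₃ = 4` on both sides), `41` SPLIT (`−163 ≡ 1 (mod 41)`), `2` INERT of positive defect: `S_in = {2}`, one free bit.
research route conditional on HC_CM; not a corollary; Q11.4-sentence-2 already refuted in dim ≥ 3. [folklore] -/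
theorem psl2_163_primes :
    ¬ IsSquare (-(163 : ZMod 3)) ∧ IsSquare (-(163 : ZMod 41)) ∧ (¬ ∃ x : ZMod 8, x ^ 2 = -(163 : ZMod 8)) ∧
      padicValNat 3 (163 * ((163 - 1) / 2) * (163 + 1)) = padicValNat 3 ((163 - 1) / 2) ∧
      163 * ((163 - 1) / 2) * (163 + 1) = 2165292 := by
  refine ⟨by decide, by decide, by decide, ?_, by norm_num⟩
  exact padicValNat_psl2Order_eq_of_not_isSquare (q := 163) Nat.prime_three (by norm_num) (by decide)

/-- `GL₂(𝔽₃)` (`|G| = 48 = 2⁴·3`, the degree-2 character with `ℚ(χ) = ℚ(√-2)`): `3` is SPLIT in `ℚ(√-2)`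
(`−2 ≡ 1 (mod 3)`), `Ram(ℚ(√-2)) = {2}`: `S_in = ∅` — every such piece of every `GL₂(𝔽₃)`-curve is SPLIT by THEOREM S3
alone (the seventeen `GL₂(𝔽₃)` Weil data of b04.11 P.S. 2 / CLOSING on `W4.2.1`, `W8.2.1`), independently of
THEOREM S1/S2.
research route conditional on HC_CM; not a corollary; Q11.4-sentence-2 already refuted in dim ≥ 3. [folklore] -/
theorem gl23_three_split : IsSquare (-(2 : ZMod 3)) ∧ (48 : ℕ) = 2 ^ 4 * 3 := ⟨by decide, by norm_num⟩

/-- `SL₂(𝔽₃) = 2T` (`|G| = 24`, characters `2′, 2″` with `ℚ(√-3)`) and `A₄ = PSL₂(𝔽₃)` (`|G| = 12`, the cubic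
characters): `2` is INERT in `ℚ(√-3)` (`x² ≡ −3 (mod 8)` insoluble) and of POSITIVE defect (`v₂(24) = 3`,
`v₂(12) = 2`, degrees `2`, `1`): `S_in = {2}`, `Ram = {3}` — one free bit a priori (for `2′, 2″` the even degree closes
it by THEOREM S1: the nine `2T` data of b04.11 P.S. on `W4.3.1`/`W8.3.1`; for the cubic characters it is the cyclic
window's bit, met on both sides in b04.7).
research route conditional on HC_CM; not a corollary; Q11.4-sentence-2 already refuted in dim ≥ 3. [folklore] -/
theorem sl23_two_inert : (¬ ∃ x : ZMod 8, x ^ 2 = -(3 : ZMod 8)) ∧ padicValNat 2 24 = 3 ∧ padicValNat 2 12 = 2 := by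
  haveI : Fact (Nat.Prime 2) := ⟨Nat.prime_two⟩
  refine ⟨by decide, ?_, ?_⟩
  · rw [show (24 : ℕ) = 2 ^ 3 * 3 by norm_num, padicValNat.mul (by norm_num) (by norm_num), padicValNat.prime_pow,
      padicValNat.eq_zero_of_not_dvd (by norm_num)]
  · rw [show (12 : ℕ) = 2 ^ 2 * 3 by norm_num, padicValNat.mul (by norm_num) (by norm_num), padicValNat.prime_pow,
      padicValNat.eq_zero_of_not_dvd (by norm_num)]

end Summit.HodgeConjecture.HodgeConjecture.Ring2.WeilCoverage
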